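import Summits.MatrixMultiplication.MatrixMultiplication.Theses.DesignFlattening

/-!
# `DesignFlattening.SeparableTorusFloor` (stmt-MatrixMultiplication-8038): the determinant floor

Every separable `k`-term toric design of `xyz^{⊗N}` over the `ℤ₃` table `[a+b+c = 0]`,
`xyz^{⊗N} = Σ_{j<k} ⊗_i [a+b+c=0]·u_{ji}(a) v_{ji}(b) w_{ji}(c)` (entrywise), has `k ≥ (3/2)^N`
(card Theorem (A) of route `DesignFlattening`).

Proof.  The monomial flattening `L(x) = ((x₀₁₂, x₀₀₀, 0), (0, x₁₂₀, x₁₁₁), (−x₂₂₂, 0, x₂₀₁))`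
(a `3 × 3` matrix whose `(r,c)` entry is `σ_{rc} · x_{r, β_{rc}, γ_{rc}}` for a sign table `σ` and
cell tables `β`, `γ`) has `L(xyz) = 1` and `det L(x) = x₀₁₂ x₁₂₀ x₂₀₁ − x₀₀₀ x₁₁₁ x₂₂₂`, which
vanishes at every toric point `x = [a+b+c=0]·u(a)v(b)w(c)` (both monomials equal `(Πu)(Πv)(Πw)`),
so `rank L(t) ≤ 2` there.  Because `L` is monomial, applying it in every one of the `N`
coordinates to the design identity gives the matrix identity `1_{3^N} = Σ_j ⊗_i L(t_{ji})` (an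
iterated Kronecker product on the index type `Fin N → Fin 3`), hence
`3^N = rank 1 ≤ Σ_j Π_i rank L(t_{ji}) ≤ k · 2^N`.

The file introduces no definitions: the flattening and its tables are local terms of the proof;
the generic rank lemmas (sub-additivity, singular `3 × 3` matrices have rank `≤ 2`, rank of an
iterated Kronecker product `(r,c) ↦ Π_i M_i (r i) (c i)`) are stated on explicit matrices.
-/

open scoped BigOperators
open Literature.Computability.AlgebraicComplexity

namespace Summit.MatrixMultiplication.MatrixMultiplication.Theorems

namespace DesignFlatteningSeparableTorusFloor

/-- Over a field, a singular `3 × 3` matrix has rank `≤ 2`. [folklore] -/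
theorem rank_le_two_of_det_eq_zero {M : Matrix (Fin 3) (Fin 3) ℂ} (hM : M.det = 0) :
    M.rank ≤ 2 := by
  have h : M.rank < Fintype.card (Fin 3) := by
    refine lt_of_le_of_ne (Matrix.rank_le_card_width M) fun hr => ?_
    have htop : LinearMap.range M.mulVecLin = ⊤ := by
      apply Submodule.eq_top_of_finrank_eq
      rw [Module.finrank_fintype_fun_eq_card]
      exact hr
    have hsurj : Function.Surjective M.mulVec := by
      intro y
      have hy : y ∈ LinearMap.range M.mulVecLin := htop ▸ Submodule.mem_top
      obtain ⟨x, hx⟩ := hy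
      exact ⟨x, hx⟩
    exact ((Matrix.isUnit_iff_isUnit_det M).1
      (Matrix.mulVec_surjective_iff_isUnit.1 hsurj)).ne_zero hM
  have h3 : M.rank < 3 := by simpa using h
  omega

/-- Sub-additivity of matrix rank over a field: `rank (A + B) ≤ rank A + rank B`. [folklore] -/
theorem rank_add_le {m n : Type*} [Fintype n] (A B : Matrix m n ℂ) :
    (A + B).rank ≤ A.rank + B.rank := by
  unfold Matrix.rank
  rw [Matrix.mulVecLin_add]
  exact (Submodule.finrank_mono (LinearMap.range_add_le _ _)).trans
    (Submodule.finrank_add_le_finrank_add_finrank _ _)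

/-- `rank (Σⱼ Aⱼ) ≤ Σⱼ rank Aⱼ`. [folklore] -/
theorem rank_sum_le {m n ι : Type*} [Fintype n] (s : Finset ι) (A : ι → Matrix m n ℂ) :
    (∑ j ∈ s, A j).rank ≤ ∑ j ∈ s, (A j).rank := by
  classical
  induction s using Finset.induction_on with
  | empty => simp
  | insert a s ha ih =>
    rw [Finset.sum_insert ha, Finset.sum_insert ha]
    exact (rank_add_le _ _).trans (Nat.add_le_add_left ih _)

/-- The iterated Kronecker product `(r, c) ↦ Πᵢ Mᵢ (r i) (c i)` of identity matrices is the
identity matrix on `Fin N → Fin 3`. [folklore] -/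
theorem piKron_one (N : ℕ) :
    (Matrix.of fun r c : Fin N → Fin 3 => ∏ i, (1 : Matrix (Fin 3) (Fin 3) ℂ) (r i) (c i)) = 1 := by
  ext r c
  simp only [Matrix.of_apply, Matrix.one_apply]
  rw [Finset.prod_boole]
  by_cases h : r = c
  · subst h; simp
  · rw [if_neg h, if_neg]
    intro H
    exact h (funext fun i => H i (Finset.mem_univ i))

/-- Rank is multiplicative on iterated Kronecker products:
`rank ((r, c) ↦ Πᵢ Mᵢ (r i) (c i)) = Πᵢ rank Mᵢ` (induction on `N`, splitting off the first
coordinate by `Fin.consEquiv` and using `rank (A ⊗ B) = rank A · rank B`). [folklore] -/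
theorem rank_piKron (N : ℕ) (M : Fin N → Matrix (Fin 3) (Fin 3) ℂ) :
    (Matrix.of fun r c : Fin N → Fin 3 => ∏ i, M i (r i) (c i)).rank = ∏ i, (M i).rank := by
  induction N with
  | zero =>
    have h1 : (Matrix.of fun r c : Fin 0 → Fin 3 => ∏ i, M i (r i) (c i)) = 1 := by
      ext r c
      rw [Subsingleton.elim r c]
      simp
    rw [h1, Matrix.rank_one]
    simp
  | succ N ih =>
    set e := (Fin.consEquiv fun _ : Fin (N + 1) => Fin 3).symm with he
    have hre : Matrix.reindex e e (Matrix.of fun r c : Fin (N + 1) → Fin 3 => ∏ i, M i (r i) (c i)) =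
        Matrix.kroneckerMap (· * ·) (M 0)
          (Matrix.of fun r c : Fin N → Fin 3 => ∏ i, M i.succ (r i) (c i)) := by
      ext ⟨x, r⟩ ⟨y, c⟩
      simp [he, Matrix.reindex_apply, Matrix.submatrix_apply, Fin.prod_univ_succ]
    rw [← Matrix.rank_reindex e e, hre, matRank_kroneckerMap_mul, ih, Fin.prod_univ_succ]

end DesignFlatteningSeparableTorusFloor

open DesignFlatteningSeparableTorusFloor in
/-- **Card Theorem (A) of route `DesignFlattening`** (closes stmt-MatrixMultiplication-8038): every
separable `k`-term toric design of `xyz^{⊗N}` over the `ℤ₃` table has `(3/2)^N ≤ k`, by the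
determinant flattening `L(x) = ((x₀₁₂, x₀₀₀, 0), (0, x₁₂₀, x₁₁₁), (−x₂₂₂, 0, x₂₀₁))`
(`L(xyz) = 1`, `det L = x₀₁₂x₁₂₀x₂₀₁ − x₀₀₀x₁₁₁x₂₂₂ = 0` hence `rank L ≤ 2` on toric points; ranks
multiply under Kronecker products and are sub-additive, so `3^N ≤ k · 2^N`). [folklore] -/
theorem SeparableTorusFloor_proof :
    Summit.MatrixMultiplication.MatrixMultiplication.Theses.DesignFlattening.SeparableTorusFloor := by
  unfold Summit.MatrixMultiplication.MatrixMultiplication.Theses.DesignFlattening.SeparableTorusFloor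
  intro N k u v w h
  -- the flattening `L` in coordinates: entry `(r, c)` of `L x` is `σ r c * x r (β r c) (γ r c)`
  set σ : Fin 3 → Fin 3 → ℂ := ![![1, 1, 0], ![0, 1, 1], ![-1, 0, 1]] with hσ
  set β : Fin 3 → Fin 3 → Fin 3 := ![![1, 0, 0], ![0, 2, 1], ![2, 0, 0]] with hβ
  set γ : Fin 3 → Fin 3 → Fin 3 := ![![2, 0, 0], ![0, 0, 1], ![2, 0, 1]] with hγ
  set L : (Fin 3 → Fin 3 → Fin 3 → ℂ) → Matrix (Fin 3) (Fin 3) ℂ :=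
    fun x => Matrix.of fun r c => σ r c * x r (β r c) (γ r c) with hL
  -- its `N`-th Kronecker power, acting on arrays indexed by `(Fin N → Fin 3)³`
  set LN : ((Fin N → Fin 3) → (Fin N → Fin 3) → (Fin N → Fin 3) → ℂ) →
      Matrix (Fin N → Fin 3) (Fin N → Fin 3) ℂ :=
    fun T => Matrix.of fun r c =>
      (∏ i, σ (r i) (c i)) * T r (fun i => β (r i) (c i)) (fun i => γ (r i) (c i)) with hLN
  -- `L(xyz) = 1`
  have hLxyz : L (xyzTensor ℂ) = 1 := by
    ext r c
    fin_cases r <;> fin_cases c <;> simp [hL, hσ, hβ, hγ, xyzTensor, comp1]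
  -- `det L(t) = 0` at toric points
  have hLdet : ∀ u' v' w' : Fin 3 → ℂ,
      (L (fun a b c => (if a + b + c = 0 then (1 : ℂ) else 0) * u' a * v' b * w' c)).det = 0 := by
    intro u' v' w'
    rw [Matrix.det_fin_three]
    simp [hL, hσ, hβ, hγ]
    ring
  -- `L^{⊗N}` of an elementary array is the iterated Kronecker product of the `L(t_i)`
  have hLN_prod : ∀ t : Fin N → Fin 3 → Fin 3 → Fin 3 → ℂ,
      LN (fun a b c => ∏ i, t i (a i) (b i) (c i)) =
        Matrix.of fun r c : Fin N → Fin 3 => ∏ i, L (t i) (r i) (c i) := by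
    intro t
    ext r c
    simp only [hLN, hL, Matrix.of_apply, ← Finset.prod_mul_distrib]
  -- `L^{⊗N}` is additive
  have hLN_sum : ∀ f : Fin k → (Fin N → Fin 3) → (Fin N → Fin 3) → (Fin N → Fin 3) → ℂ,
      LN (fun a b c => ∑ j, f j a b c) = ∑ j, LN (f j) := by
    intro f
    ext r c
    simp only [hLN, Matrix.of_apply, Matrix.sum_apply, Finset.mul_sum]
  -- the toric factors of the design
  set t : Fin k → Fin N → Fin 3 → Fin 3 → Fin 3 → ℂ :=
    fun j i a b c => (if a + b + c = 0 then (1 : ℂ) else 0) * u j i a * v j i b * w j i c with ht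
  -- the matrix identity `1 = Σ_j ⊗_i L(t_{ji})`
  have hid : (1 : Matrix (Fin N → Fin 3) (Fin N → Fin 3) ℂ) =
      ∑ j, Matrix.of fun r c : Fin N → Fin 3 => ∏ i, L (t j i) (r i) (c i) := by
    have hl : LN (kroneckerPow (xyzTensor ℂ) N) = 1 := by
      rw [show kroneckerPow (xyzTensor ℂ) N =
          fun a b c => ∏ i, (fun _ : Fin N => xyzTensor ℂ) i (a i) (b i) (c i) from rfl,
        hLN_prod, hLxyz, piKron_one]
    have hr : LN (kroneckerPow (xyzTensor ℂ) N) =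
        ∑ j, Matrix.of fun r c : Fin N → Fin 3 => ∏ i, L (t j i) (r i) (c i) := by
      have e1 : kroneckerPow (xyzTensor ℂ) N =
          fun a b c => ∑ j, (fun j a b c => ∏ i, t j i (a i) (b i) (c i)) j a b c :=
        funext fun a => funext fun b => funext fun c => h a b c
      rw [e1]
      refine (hLN_sum fun j a b c => ∏ i, t j i (a i) (b i) (c i)).trans ?_
      exact Finset.sum_congr rfl fun j _ => hLN_prod (t j)
    rw [← hl, hr]
  -- ranks: `3^N ≤ k · 2^N`
  have hrank : 3 ^ N ≤ k * 2 ^ N := by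
    have h3 : (3 : ℕ) ^ N =
        (∑ j, Matrix.of fun r c : Fin N → Fin 3 => ∏ i, L (t j i) (r i) (c i)).rank := by
      rw [← hid, Matrix.rank_one, Fintype.card_fun, Fintype.card_fin, Fintype.card_fin]
    rw [h3]
    refine (rank_sum_le _ _).trans ?_
    have hj : ∀ j : Fin k,
        (Matrix.of fun r c : Fin N → Fin 3 => ∏ i, L (t j i) (r i) (c i)).rank ≤ 2 ^ N := by
      intro j
      rw [rank_piKron]
      have := Finset.prod_le_pow_card Finset.univ (fun i => (L (t j i)).rank) 2
        fun i _ => rank_le_two_of_det_eq_zero (hLdet (u j i) (v j i) (w j i))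
      simpa using this
    calc ∑ j, (Matrix.of fun r c : Fin N → Fin 3 => ∏ i, L (t j i) (r i) (c i)).rank
        ≤ ∑ _j : Fin k, 2 ^ N := Finset.sum_le_sum fun j _ => hj j
      _ = k * 2 ^ N := by simp
  -- pass to `ℝ`
  rw [div_pow, div_le_iff₀ (by positivity)]
  exact_mod_cast hrank

end Summit.MatrixMultiplication.MatrixMultiplication.Theorems
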